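import Summits.Ventures.Crystal3D.Theorems.StickyWulffConstantTextureBuildSlabSealingLocal
import Summits.Ventures.Crystal3D.Theorems.StickyWulffConstantTextureBuildLocalAgreement
import HarnessLib

/-!
# TB-1 brick: COMPLETE REGIONS — a complete presentation owns every ball of its region, and two complete presentations of one region AGREE there
# (lane T, crux `TextureLiminfV5`, stmt-Ventures-23912; memo HOME/wulff-p2/g25/SLAB-PLATES-g25.md §7 (a))

HONEST FRAMING. Venture `Summits/Ventures/Crystal3D` (cell `crystal3d-full`), route `route-Ventures-StickyWulffConstant`, helper `--supports` the
law-v5 crux `TextureLiminfV5` (stmt-Ventures-23912).  Corollaries (census-free, standard axioms) of the Literature covering radius ('…BarlowCovering'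
`exists_mem_barlowStacking_dist_sq_le`) and of `mem_iff_mem_of_perfect_near` ('…LocalAgreement').  No cover is built; F-C1 not moved.

WHY.  The near-wall presentations of the healed `stub_TB_cover` are read by DESCENT ('…DescentFromShell' `exists_frame_descent`) from many base balls; each
certifies «every site of `stacking L b s` in its region is a ball».  To patch them into tents the constructor needs (i) that such a COMPLETE region holds no
other ball (so the tent set there IS the site set: `SolidAt`, no junk) and (ii) that two presentations complete on a common ball COINCIDE there as site sets
(the `Mesh.hagree` clause between adjacent near-wall tents, and between a near-wall tent and the charted block behind it).

* **`eq_site_of_complete_ball`** — if every site of `stacking L b s` within `r` of `q₀` is a ball of the unit packing `x`, then every ball within `r − 1` of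
  `q₀` IS a site of `stacking L b s` (ball form of '…SlabSealingLocal');
* `twelve_le_card_of_complete` — there, every ball within `r − 2` of `q₀` has twelve balls at distance `1`;
* **`stacking_agree_of_complete`** — two (Hägg) presentations both complete within `r ≥ 6` of `q₀` coincide as site sets within `r − 5` of `q₀`;
  `stacking_inter_ball_eq_of_complete` — the `S₁ ∩ ball = S₂ ∩ ball` form of `Mesh.hagree`.
-/

noncomputable section

namespace Summit.Ventures.Crystal3D.Theorems

open Literature.MathematicalPhysics.StatisticalMechanics
open Summit.Ventures.Crystal3D.Cruxes.TextureLiminf.TexShadow (stacking)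

variable {N : ℕ} {x : Fin N → EuclideanSpace ℝ (Fin 3)}

/-- **A COMPLETE BALL IS SEALED.**  If every site of `stacking L b s` within `r` of `q₀` is a ball of the unit packing `x`, then every ball within `r − 1` of `q₀`
is a site of `stacking L b s`. -/
theorem eq_site_of_complete_ball (hx : IsUnitPacking x) (L : EuclideanSpace ℝ (Fin 3) ≃ₗᵢ[ℝ] EuclideanSpace ℝ (Fin 3)) (b : EuclideanSpace ℝ (Fin 3))
    (s : ℤ → ℤ) (q₀ : EuclideanSpace ℝ (Fin 3)) (r : ℝ)
    (hcomp : ∀ w ∈ stacking L b s, dist w q₀ ≤ r → w ∈ Set.range x) :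
    ∀ c : Fin N, dist (x c) q₀ ≤ r - 1 → x c ∈ stacking L b s := by
  intro c hc
  obtain ⟨p, hp, hd⟩ := exists_mem_barlowStacking_dist_sq_le one_ne_zero (Real.sqrt_pos.2 (by norm_num : (0 : ℝ) < 2 / 3)) s
    (L.symm (x c - b))
  have hsq : Real.sqrt (2 / 3) ^ 2 = 2 / 3 := Real.sq_sqrt (by norm_num)
  rw [hsq] at hd
  have hd1 : dist (L.symm (x c - b)) p < 1 := by
    nlinarith [dist_nonneg (x := L.symm (x c - b)) (y := p)]
  have hw : L p + b ∈ stacking L b s := ⟨p, hp, rfl⟩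
  have hdw : dist (x c) (L p + b) < 1 := by rw [dist_moved_eq']; exact hd1
  have hwq : dist (L p + b) q₀ ≤ r := by
    have := dist_triangle (L p + b) (x c) q₀
    rw [dist_comm (L p + b) (x c)] at this
    linarith
  obtain ⟨c', hc'⟩ := hcomp _ hw hwq
  by_cases hcc : c = c'
  · subst hcc; rw [hc']; exact hw
  · exfalso
    have h1 : 1 ≤ dist (x c) (x c') := hx hcc
    rw [hc'] at h1
    exact absurd hdw (not_lt.2 h1)

/-- In a complete ball every ball within `r − 2` of the centre has twelve balls at distance `1` (its twelve site neighbours). -/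
theorem twelve_le_card_of_complete (hx : IsUnitPacking x) {L : EuclideanSpace ℝ (Fin 3) ≃ₗᵢ[ℝ] EuclideanSpace ℝ (Fin 3)} {b : EuclideanSpace ℝ (Fin 3)}
    {s : ℤ → ℤ} (hs : IsHaggSeq s) (q₀ : EuclideanSpace ℝ (Fin 3)) (r : ℝ)
    (hcomp : ∀ w ∈ stacking L b s, dist w q₀ ≤ r → w ∈ Set.range x) :
    ∀ y ∈ Finset.univ.image x, dist y q₀ ≤ r - 2 → 12 ≤ ((Finset.univ.image x).filter fun z => dist y z = 1).card := by
  classical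
  intro y hy hyd
  obtain ⟨c, -, rfl⟩ := Finset.mem_image.1 hy
  have hcS : x c ∈ stacking L b s := eq_site_of_complete_ball hx L b s q₀ r hcomp c (by linarith)
  have hT := ncard_touching_stacking_eq_twelve hs hcS
  have hTfin : {z | z ∈ stacking L b s ∧ dist (x c) z = 1}.Finite := Set.finite_of_ncard_pos (by rw [hT]; norm_num)
  have hsub : {z | z ∈ stacking L b s ∧ dist (x c) z = 1} ⊆ ↑((Finset.univ.image x).filter fun z => dist (x c) z = 1) := by
    rintro z ⟨hzS, hzd⟩
    have hzq : dist z q₀ ≤ r := by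
      have := dist_triangle z (x c) q₀
      rw [dist_comm z (x c), hzd] at this
      linarith
    obtain ⟨c', hc'⟩ := hcomp z hzS hzq
    exact Finset.mem_coe.2 (Finset.mem_filter.2 ⟨Finset.mem_image.2 ⟨c', Finset.mem_univ _, hc'⟩, hzd⟩)
  have h := Set.ncard_le_ncard hsub (Finset.finite_toSet _)
  rw [hT, Set.ncard_coe_finset] at h
  exact h

/-- **TWO COMPLETE PRESENTATIONS AGREE.**  If two Hägg presentations `stacking L₁ b₁ s₁`, `stacking L₂ b₂ s₂` both have every site within `r ≥ 6` of `q₀` occupied by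
a ball of the unit packing `x`, then they coincide as site sets within `r − 5` of `q₀`. -/
theorem stacking_agree_of_complete (hx : IsUnitPacking x) {L₁ L₂ : EuclideanSpace ℝ (Fin 3) ≃ₗᵢ[ℝ] EuclideanSpace ℝ (Fin 3)}
    {b₁ b₂ : EuclideanSpace ℝ (Fin 3)} {s₁ s₂ : ℤ → ℤ} (hs₁ : IsHaggSeq s₁) (hs₂ : IsHaggSeq s₂) (q₀ : EuclideanSpace ℝ (Fin 3)) {r : ℝ} (hr : 6 ≤ r)
    (hcomp₁ : ∀ w ∈ stacking L₁ b₁ s₁, dist w q₀ ≤ r → w ∈ Set.range x)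
    (hcomp₂ : ∀ w ∈ stacking L₂ b₂ s₂, dist w q₀ ≤ r → w ∈ Set.range x) :
    ∀ z : EuclideanSpace ℝ (Fin 3), dist z q₀ ≤ r - 5 → (z ∈ stacking L₁ b₁ s₁ ↔ z ∈ stacking L₂ b₂ s₂) := by
  classical
  -- a ball `p₀` near `q₀`: the site of presentation 1 nearest to `q₀` is occupied
  obtain ⟨p, hp, hd⟩ := exists_mem_barlowStacking_dist_sq_le one_ne_zero (Real.sqrt_pos.2 (by norm_num : (0 : ℝ) < 2 / 3)) s₁
    (L₁.symm (q₀ - b₁))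
  have hsq : Real.sqrt (2 / 3) ^ 2 = 2 / 3 := Real.sq_sqrt (by norm_num)
  rw [hsq] at hd
  have hd1 : dist (L₁.symm (q₀ - b₁)) p < 1 := by
    nlinarith [dist_nonneg (x := L₁.symm (q₀ - b₁)) (y := p)]
  have hw : L₁ p + b₁ ∈ stacking L₁ b₁ s₁ := ⟨p, hp, rfl⟩
  have hdw : dist q₀ (L₁ p + b₁) < 1 := by rw [dist_moved_eq']; exact hd1
  obtain ⟨c₀, hc₀⟩ := hcomp₁ _ hw (by rw [dist_comm]; linarith)
  have hp₀q : dist (x c₀) q₀ < 1 := by rw [hc₀, dist_comm]; exact hdw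
  -- hypotheses of `mem_iff_mem_of_perfect_near` at `p₀ = x c₀`, radius `R = r − 4`
  have hp₀ : x c₀ ∈ Finset.univ.image x := Finset.mem_image.2 ⟨c₀, Finset.mem_univ _, rfl⟩
  have hp₀S₁ : x c₀ ∈ stacking L₁ b₁ s₁ := eq_site_of_complete_ball hx L₁ b₁ s₁ q₀ r hcomp₁ c₀ (by linarith)
  have hp₀S₂ : x c₀ ∈ stacking L₂ b₂ s₂ := eq_site_of_complete_ball hx L₂ b₂ s₂ q₀ r hcomp₂ c₀ (by linarith)
  have hS₁ : ∀ y ∈ Finset.univ.image x, dist y (x c₀) ≤ (r - 4) + 2 → y ∈ stacking L₁ b₁ s₁ := by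
    intro y hy hyd
    obtain ⟨c, -, rfl⟩ := Finset.mem_image.1 hy
    refine eq_site_of_complete_ball hx L₁ b₁ s₁ q₀ r hcomp₁ c ?_
    have := dist_triangle (x c) (x c₀) q₀
    linarith
  have hS₂ : ∀ y ∈ Finset.univ.image x, dist y (x c₀) ≤ (r - 4) + 2 → y ∈ stacking L₂ b₂ s₂ := by
    intro y hy hyd
    obtain ⟨c, -, rfl⟩ := Finset.mem_image.1 hy
    refine eq_site_of_complete_ball hx L₂ b₂ s₂ q₀ r hcomp₂ c ?_
    have := dist_triangle (x c) (x c₀) q₀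
    linarith
  have h12 : ∀ y ∈ Finset.univ.image x, dist y (x c₀) ≤ (r - 4) + 1 →
      12 ≤ ((Finset.univ.image x).filter fun z => dist y z = 1).card := by
    intro y hy hyd
    refine twelve_le_card_of_complete hx hs₁ q₀ r hcomp₁ y hy ?_
    obtain ⟨c, -, rfl⟩ := Finset.mem_image.1 hy
    have := dist_triangle (x c) (x c₀) q₀
    linarith
  intro z hz
  refine mem_iff_mem_of_perfect_near hs₁ hs₂ (Finset.univ.image x) hp₀ hp₀S₁ hp₀S₂ (r - 4) hS₁ hS₂ h12 z ?_
  have := dist_triangle z q₀ (x c₀)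
  rw [dist_comm q₀ (x c₀)] at this
  linarith

/-- **`Mesh.hagree` form**: under the hypotheses of `stacking_agree_of_complete`, `S₁ ∩ ball y ρ = S₂ ∩ ball y ρ` for every ball inside `closedBall q₀ (r − 5)`. -/
theorem stacking_inter_ball_eq_of_complete (hx : IsUnitPacking x) {L₁ L₂ : EuclideanSpace ℝ (Fin 3) ≃ₗᵢ[ℝ] EuclideanSpace ℝ (Fin 3)}
    {b₁ b₂ : EuclideanSpace ℝ (Fin 3)} {s₁ s₂ : ℤ → ℤ} (hs₁ : IsHaggSeq s₁) (hs₂ : IsHaggSeq s₂) (q₀ : EuclideanSpace ℝ (Fin 3)) {r : ℝ} (hr : 6 ≤ r)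
    (hcomp₁ : ∀ w ∈ stacking L₁ b₁ s₁, dist w q₀ ≤ r → w ∈ Set.range x)
    (hcomp₂ : ∀ w ∈ stacking L₂ b₂ s₂, dist w q₀ ≤ r → w ∈ Set.range x)
    {y : EuclideanSpace ℝ (Fin 3)} {ρ : ℝ} (hyρ : Metric.ball y ρ ⊆ Metric.closedBall q₀ (r - 5)) :
    stacking L₁ b₁ s₁ ∩ Metric.ball y ρ = stacking L₂ b₂ s₂ ∩ Metric.ball y ρ := by
  ext z
  simp only [Set.mem_inter_iff]
  constructor
  · rintro ⟨hz, hzb⟩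
    exact ⟨(stacking_agree_of_complete hx hs₁ hs₂ q₀ hr hcomp₁ hcomp₂ z (Metric.mem_closedBall.1 (hyρ hzb))).1 hz, hzb⟩
  · rintro ⟨hz, hzb⟩
    exact ⟨(stacking_agree_of_complete hx hs₁ hs₂ q₀ hr hcomp₁ hcomp₂ z (Metric.mem_closedBall.1 (hyρ hzb))).2 hz, hzb⟩

end Summit.Ventures.Crystal3D.Theorems

end
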